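import Mathlib
import Summits.Schanuel.Schanuel.Theses.RigidCore
import Summits.Schanuel.Schanuel.Theorems.RigidCoreMinimalCounterexampleInAclMateFirstFailure
import Summits.Schanuel.Schanuel.Theorems.RigidCoreMinimalCounterexampleInAclSweepToSubspaceOfLine
import Literature.NumberTheory.Transcendental.LocusComponents

/-!
# Stub `stub_sweepLine_algPeriod` (crux stmt-Schanuel-0969, line kernel-arithmetic-selection)

`x` a first failure of rank `n ≥ 3` (ℚ-linearly independent, `trdeg ℚ(x, eˣ) < n`, Schanuel in
ranks `< n`), `y = eˣ`, `P = ker (aeval (x, y)) ⊆ ℚ[X, Y]`, `W_y = {z | p(z, y) = 0 ∀ p ∈ P}` the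
fibre of the ℚ-locus, `D = {k ∈ ℤⁿ | x + 2πik is a mate}` (infinite by hypothesis), and `2πi`
ALGEBRAIC over `ℚ(y)`.  We produce `k₀ ∈ D`, `v ∈ ℤⁿ ∖ 0` with the line `x + 2πik₀ + ℂv ⊆ W_y`.
Proof.  Clearing denominators, `M(y, 2πi) = 0` for some `M ∈ ℚ[Y][T]` with `M(y, T) ≠ 0`.  Every
mate-translate `ζ_k = (x + 2πik, y)`, `k ∈ D`, is a GENERIC point of `P`
(`algPeriod_isGenericPt_kerTranslate`, from `stub_mateFirstFailure`), so it induces an embedding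
`ι_k : L = Frac(ℚ[X,Y]⧸P) → ℂ` with `ι_k ∘ (ℚ[X,Y] → L) = aeval ζ_k`.  The kernel `I_k ⊆ L[T]` of
`g ↦ (ι_k g)(2πi)` is a prime
containing the image `m ≠ 0` of `M`, hence a minimal prime of `(m)` in the PID `L[T]`; these are
finitely many, so `I_{k₁} = I_{k₂}` for some `k₁ ≠ k₂` in the infinite set `D` (pigeonhole), whence
`f(ζ_{k₁}, 2πi) = 0 ↔ f(ζ_{k₂}, 2πi) = 0` for all `f ∈ ℚ[X, Y][T]`.  The shear
`φ : X ↦ X + T(k₂ - k₁)` of `ℚ[X,Y][T]` satisfies `f(ζ_{k₂}, 2πi) = (φ f)(ζ_{k₁}, 2πi)`, so the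
common kernel is `φ`-stable, and iterating, `p(x + 2πik₁ + j·2πi(k₂ - k₁), y) = 0` for all
`p ∈ P`, `j ∈ ℕ`: the line `x + 2πik₁ + ℂ(k₂ - k₁)` meets `W_y` in infinitely many points, hence
lies in it (`aeval_line_eq_zero_of_infinite` of the sibling file `…SweepToSubspaceOfLine`).
-/

noncomputable section

set_option linter.dupNamespace false

open Complex Set

namespace Summit.Schanuel.Schanuel.Cruxes.MinimalCounterexampleInAcl.KernelArithmeticSelection

open Literature.NumberTheory.Transcendental (SchanuelRank IsGenericPt zeroLocusFunctionField)

variable {n : ℕ}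

/-! ### Mate-translates are generic points (from `stub_mateFirstFailure`) -/

/-- **The mate-translates of a first failure are generic points of its locus**: if `x` is a first
failure of rank `n` and `x' = x + 2πik` is a mate, then `I((x', eˣ)/ℚ) = P = ker (aeval (x, eˣ))`
(`stub_mateFirstFailure`: the pulled-back loci of `x` and `x'` coincide, so `P_{x'} = P_x`; and
`e^{x'} = eˣ`). -/
theorem algPeriod_isGenericPt_kerTranslate (x : Fin n → ℂ)
    (hx : LinearIndependent ℚ x ∧ Algebra.trdeg ℚ
      ↥(IntermediateField.adjoin ℚ (Set.range x ∪ Set.range (Complex.exp ∘ x))) < (n : Cardinal) ∧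
      ∀ r < n, Literature.NumberTheory.Transcendental.SchanuelRank r)
    (k : Fin n → ℤ)
    (hk : LinearIndependent ℚ (fun i => x i + 2 * ↑Real.pi * Complex.I * (k i : ℂ)) ∧
      ∀ p : MvPolynomial (Fin n ⊕ Fin n) ℚ,
        MvPolynomial.aeval (Sum.elim x (Complex.exp ∘ x)) p = 0 →
        MvPolynomial.aeval (Sum.elim (fun i => x i + 2 * ↑Real.pi * Complex.I * (k i : ℂ))
          (Complex.exp ∘ fun i => x i + 2 * ↑Real.pi * Complex.I * (k i : ℂ))) p = 0) :
    IsGenericPt (RingHom.ker (MvPolynomial.aeval (Sum.elim x (Complex.exp ∘ x)) :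
        MvPolynomial (Fin n ⊕ Fin n) ℚ →ₐ[ℚ] ℂ))
      (Sum.elim (fun i => x i + 2 * ↑Real.pi * Complex.I * (k i : ℂ)) (Complex.exp ∘ x)) := by
  have hsets := (stub_mateFirstFailure n x _ hx hk).2
  intro p
  rw [RingHom.mem_ker]
  refine ⟨fun hp => ?_, fun hp => ?_⟩
  · have hxmem : x ∈ {x'' : Fin n → ℂ | ∀ p : MvPolynomial (Fin n ⊕ Fin n) ℚ,
        MvPolynomial.aeval (Sum.elim x (Complex.exp ∘ x)) p = 0 →
        MvPolynomial.aeval (Sum.elim x'' (Complex.exp ∘ x'')) p = 0} := fun q hq => hq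
    rw [← hsets] at hxmem
    exact hxmem p (by rwa [cexp_kerTranslate])
  · have := hk.2 p hp
    rwa [cexp_kerTranslate] at this

/-! ### An integral relation for `2πi` over `ℚ[y]` -/

/-- If `t` is algebraic over the field `ℚ(y)`, then `M(y, t) = 0` for some `M ∈ ℚ[Y][T]` with
`M(y, T) ≠ 0` (pass to the subalgebra `ℚ[y]`, of which `ℚ(y)` is the fraction field, and lift the
coefficients along the surjection `ℚ[Y] → ℚ[y]`). -/
theorem algPeriod_exists_intRel (y : Fin n → ℂ) (t : ℂ)
    (h : IsAlgebraic ↥(IntermediateField.adjoin ℚ (Set.range y)) t) :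
    ∃ M : Polynomial (MvPolynomial (Fin n) ℚ),
      M.map (MvPolynomial.eval₂Hom (algebraMap ℚ ℂ) y) ≠ 0 ∧
      Polynomial.eval₂ (MvPolynomial.eval₂Hom (algebraMap ℚ ℂ) y) t M = 0 := by
  classical
  set B : Subalgebra ℚ ℂ := Algebra.adjoin ℚ (Set.range y) with hB
  have h' : IsAlgebraic B t := by
    open scoped IntermediateField.algebraAdjoinAdjoin in
    exact (IsFractionRing.isAlgebraic_iff B (IntermediateField.adjoin ℚ (Set.range y)) ℂ).2 h
  obtain ⟨p₁, hp₁, hp₁t⟩ := h'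
  have hBeq : B = (MvPolynomial.aeval y).range := Algebra.adjoin_range_eq_range_aeval ℚ y
  let g : MvPolynomial (Fin n) ℚ →ₐ[ℚ] B :=
    (MvPolynomial.aeval y).codRestrict B fun f => by rw [hBeq]; exact ⟨f, rfl⟩
  have hg : Function.Surjective g := by
    rintro ⟨b, hb⟩
    rw [hBeq] at hb
    obtain ⟨f, rfl⟩ := hb
    exact ⟨f, rfl⟩
  have hcomp : (algebraMap B ℂ).comp (g : MvPolynomial (Fin n) ℚ →+* B) =
      MvPolynomial.eval₂Hom (algebraMap ℚ ℂ) y := RingHom.ext fun f => rfl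
  obtain ⟨M, hM⟩ := Polynomial.map_surjective (g : MvPolynomial (Fin n) ℚ →+* B) hg p₁
  refine ⟨M, ?_, ?_⟩
  · rw [← hcomp, ← Polynomial.map_map, hM,
      Polynomial.map_ne_zero_iff (FaithfulSMul.algebraMap_injective B ℂ)]
    exact hp₁
  · rw [← hcomp, ← Polynomial.eval₂_map, hM]
    exact hp₁t

/-! ### Two distinct generic translates with the same ideal over `ℚ[X, Y][T]` -/

/-- The embedding `ι_ζ : Frac(ℚ[X,Y]⧸P) → ℂ` attached to a generic point `ζ` of `P` restricts to
`aeval ζ` on `ℚ[X, Y]`. -/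
theorem algPeriod_lift_algebraMap (P : Ideal (MvPolynomial (Fin n ⊕ Fin n) ℚ)) [P.IsPrime]
    {ζ : Fin n ⊕ Fin n → ℂ} (hζ : IsGenericPt P ζ) (a : MvPolynomial (Fin n ⊕ Fin n) ℚ) :
    Literature.NumberTheory.Transcendental.LocusComponents.liftOfIsGenericPt P hζ
        (algebraMap (MvPolynomial (Fin n ⊕ Fin n) ℚ) (zeroLocusFunctionField P) a) =
      MvPolynomial.aeval ζ a := by
  have h : (Literature.NumberTheory.Transcendental.LocusComponents.liftOfIsGenericPt P hζ).comp
      (IsScalarTower.toAlgHom ℚ (MvPolynomial (Fin n ⊕ Fin n) ℚ) (zeroLocusFunctionField P)) =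
      MvPolynomial.aeval ζ := by
    refine MvPolynomial.algHom_ext fun j => ?_
    rw [AlgHom.comp_apply, IsScalarTower.toAlgHom_apply, MvPolynomial.aeval_X]
    exact Literature.NumberTheory.Transcendental.LocusComponents.liftOfIsGenericPt_genericPt P hζ j
  exact AlgHom.congr_fun h a

/-- **Pigeonhole on minimal primes.** Let `P ⊆ ℚ[X, Y]` be prime, `y ∈ ℂⁿ`, `c ∈ ℂ` algebraic over
`ℚ(y)`, and `G ⊆ ℂⁿ` an infinite set of `a` with `(a, y)` a generic point of `P`.  Then two distinct
`a₁, a₂ ∈ G` have the same ideal of relations of `(a, y, c)` over `ℚ[X, Y][T]`: the ideal of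
`(a, y, c)` is the pull-back of the kernel `I_a ⊆ L[T]`, `L = Frac(ℚ[X,Y]⧸P)`, of `g ↦ (ι_a g)(c)`
(`ι_a : L → ℂ` the embedding attached to the generic point), and `I_a` is a minimal prime of the
principal ideal `(m)`, `m ≠ 0` the image of an integral relation `M(y, c) = 0`; the minimal primes
of `(m)` in the Noetherian ring `L[T]` are finitely many. -/
theorem algPeriod_exists_ne_ker_eq (P : Ideal (MvPolynomial (Fin n ⊕ Fin n) ℚ)) [P.IsPrime]
    (y : Fin n → ℂ) (c : ℂ) (hc : IsAlgebraic ↥(IntermediateField.adjoin ℚ (Set.range y)) c)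
    {G : Set (Fin n → ℂ)} (hG : G.Infinite) (hgen : ∀ a ∈ G, IsGenericPt P (Sum.elim a y)) :
    ∃ a₁ ∈ G, ∃ a₂ ∈ G, a₁ ≠ a₂ ∧ ∀ f : Polynomial (MvPolynomial (Fin n ⊕ Fin n) ℚ),
      Polynomial.eval₂RingHom (MvPolynomial.eval₂Hom (algebraMap ℚ ℂ) (Sum.elim a₁ y)) c f = 0 ↔
        Polynomial.eval₂RingHom (MvPolynomial.eval₂Hom (algebraMap ℚ ℂ) (Sum.elim a₂ y)) c f = 0 :=
    by
  classical
  obtain ⟨M, hM0, hMc⟩ := algPeriod_exists_intRel y c hc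
  -- the relation lifted to `ℚ[X, Y][T]`, the reduction `θ : ℚ[X,Y][T] → L[T]`, and `m = θ(M)`
  set ρ : MvPolynomial (Fin n) ℚ →+* MvPolynomial (Fin n ⊕ Fin n) ℚ :=
    ((MvPolynomial.rename Sum.inr : MvPolynomial (Fin n) ℚ →ₐ[ℚ] MvPolynomial (Fin n ⊕ Fin n) ℚ) :
      MvPolynomial (Fin n) ℚ →+* MvPolynomial (Fin n ⊕ Fin n) ℚ) with hρ
  set θ : Polynomial (MvPolynomial (Fin n ⊕ Fin n) ℚ) →+* Polynomial (zeroLocusFunctionField P) :=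
    Polynomial.mapRingHom
      (algebraMap (MvPolynomial (Fin n ⊕ Fin n) ℚ) (zeroLocusFunctionField P)) with hθ
  set m : Polynomial (zeroLocusFunctionField P) := θ (M.map ρ) with hm
  have hren : ∀ a : Fin n → ℂ, (MvPolynomial.eval₂Hom (algebraMap ℚ ℂ) (Sum.elim a y)).comp ρ =
      MvPolynomial.eval₂Hom (algebraMap ℚ ℂ) y := fun a => RingHom.ext fun p => by
    simp only [hρ, RingHom.comp_apply, RingHom.coe_coe, MvPolynomial.eval₂Hom_rename,
      Sum.elim_comp_inr]
  -- the embeddings `ι_a : L → ℂ`, `a ∈ G`, and the factorisation of evaluation through `θ`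
  let ι : G → (zeroLocusFunctionField P →ₐ[ℚ] ℂ) := fun a =>
    Literature.NumberTheory.Transcendental.LocusComponents.liftOfIsGenericPt P (hgen a.1 a.2)
  have hιcomp : ∀ a : G, (ι a : zeroLocusFunctionField P →+* ℂ).comp
      (algebraMap (MvPolynomial (Fin n ⊕ Fin n) ℚ) (zeroLocusFunctionField P)) =
      MvPolynomial.eval₂Hom (algebraMap ℚ ℂ) (Sum.elim (a : Fin n → ℂ) y) := fun a =>
    RingHom.ext fun b => algPeriod_lift_algebraMap P (hgen a.1 a.2) b
  have hfac : ∀ a : G,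
      Polynomial.eval₂RingHom (MvPolynomial.eval₂Hom (algebraMap ℚ ℂ) (Sum.elim (a : Fin n → ℂ) y))
        c = (Polynomial.eval₂RingHom (ι a : zeroLocusFunctionField P →+* ℂ) c).comp θ := by
    intro a
    refine Polynomial.ringHom_ext' (RingHom.ext fun b => ?_) ?_
    · simp only [RingHom.comp_apply, Polynomial.coe_eval₂RingHom, Polynomial.eval₂_C, hθ,
        Polynomial.coe_mapRingHom, Polynomial.map_C]
      exact (algPeriod_lift_algebraMap P (hgen a.1 a.2) b).symm
    · simp only [RingHom.comp_apply, Polynomial.coe_eval₂RingHom, Polynomial.eval₂_X, hθ,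
        Polynomial.coe_mapRingHom, Polynomial.map_X]
  -- the prime ideals `I_a ⊆ L[T]`; they contain `m ≠ 0`
  let I : G → Ideal (Polynomial (zeroLocusFunctionField P)) := fun a =>
    RingHom.ker (Polynomial.eval₂RingHom (ι a : zeroLocusFunctionField P →+* ℂ) c)
  have hIprime : ∀ a, (I a).IsPrime := fun a => RingHom.ker_isPrime _
  have hEI : ∀ (a : G) (f : Polynomial (MvPolynomial (Fin n ⊕ Fin n) ℚ)),
      Polynomial.eval₂RingHom (MvPolynomial.eval₂Hom (algebraMap ℚ ℂ) (Sum.elim (a : Fin n → ℂ) y))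
        c f = 0 ↔ θ f ∈ I a := fun a f => by
    rw [hfac a, RingHom.comp_apply, RingHom.mem_ker]
  have hmI : ∀ a, m ∈ I a := fun a => (hEI a _).1 (by
    rw [Polynomial.coe_eval₂RingHom, Polynomial.eval₂_map, hren a]; exact hMc)
  obtain ⟨a₀, ha₀⟩ := hG.nonempty
  have hm0 : m ≠ 0 := by
    intro h0
    have h1 : m.map (ι ⟨a₀, ha₀⟩ : zeroLocusFunctionField P →+* ℂ) = 0 := by
      rw [h0, Polynomial.map_zero]
    rw [hm, hθ, Polynomial.coe_mapRingHom, Polynomial.map_map, hιcomp, Polynomial.map_map,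
      hren] at h1
    exact hM0 h1
  -- `I_a` is a minimal prime of `(m)`: pigeonhole
  have hImin : ∀ a : G, I a ∈ (Ideal.span {m}).minimalPrimes := by
    intro a
    refine ⟨⟨hIprime a, (Ideal.span_singleton_le_iff_mem _).2 (hmI a)⟩, ?_⟩
    rintro q ⟨hq, hmq⟩ hqI
    have hqne : q ≠ ⊥ := by
      rintro rfl
      exact hm0 (Ideal.mem_bot.1 ((Ideal.span_singleton_le_iff_mem _).1 hmq))
    exact ((IsPrime.to_maximal_ideal hqne).eq_of_le (hIprime a).ne_top hqI).ge
  haveI : Infinite G := hG.to_subtype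
  haveI : Finite (Ideal.span {m}).minimalPrimes :=
    (Ideal.finite_minimalPrimes_of_isNoetherianRing _ (Ideal.span {m})).to_subtype
  obtain ⟨a₁, a₂, hne, heq⟩ := Finite.exists_ne_map_eq_of_infinite
    fun a : G => (⟨I a, hImin a⟩ : (Ideal.span {m}).minimalPrimes)
  have hI12 : I a₁ = I a₂ := congrArg Subtype.val heq
  refine ⟨a₁, a₁.2, a₂, a₂.2, fun h => hne (Subtype.ext h), fun f => ?_⟩
  rw [hEI a₁, hEI a₂, hI12]

/-! ### The shear `X ↦ X + T·v` and the registered stub -/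

/-- **Shear identity.** For `v ∈ ℤⁿ`, the ring endomorphism `φ_v : X_i ↦ X_i + T v_i, Y ↦ Y, T ↦ T`
of `ℚ[X, Y][T]` intertwines the evaluations at `(a, y, c)` and `(a + c v, y, c)`:
`f(a + cv, y, c) = (φ_v f)(a, y, c)`. -/
theorem algPeriod_shear_comp (y a : Fin n → ℂ) (c : ℂ) (v : Fin n → ℤ) :
    (Polynomial.eval₂RingHom (MvPolynomial.eval₂Hom (algebraMap ℚ ℂ) (Sum.elim a y)) c).comp
      (Polynomial.eval₂RingHom (MvPolynomial.eval₂Hom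
        (algebraMap ℚ (Polynomial (MvPolynomial (Fin n ⊕ Fin n) ℚ)))
        (Sum.elim (fun i => Polynomial.C (MvPolynomial.X (Sum.inl i)) +
          Polynomial.X * Polynomial.C (MvPolynomial.C (v i : ℚ)))
          (fun i => Polynomial.C (MvPolynomial.X (Sum.inr i))))) Polynomial.X) =
    Polynomial.eval₂RingHom
      (MvPolynomial.eval₂Hom (algebraMap ℚ ℂ) (Sum.elim (fun i => a i + c * (v i : ℂ)) y)) c := by
  refine Polynomial.ringHom_ext' (MvPolynomial.ringHom_ext' (RingHom.ext_rat _ _) fun j => ?_) ?_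
  · rcases j with i | i
    · simp only [RingHom.comp_apply, Polynomial.coe_eval₂RingHom, Polynomial.eval₂_C,
        MvPolynomial.coe_eval₂Hom, MvPolynomial.eval₂_X, Sum.elim_inl, Polynomial.eval₂_add,
        Polynomial.eval₂_mul, Polynomial.eval₂_X, MvPolynomial.eval₂_C]
      simp only [map_intCast]
    · simp only [RingHom.comp_apply, Polynomial.coe_eval₂RingHom, Polynomial.eval₂_C,
        MvPolynomial.coe_eval₂Hom, MvPolynomial.eval₂_X, Sum.elim_inr]
  · simp only [RingHom.comp_apply, Polynomial.coe_eval₂RingHom, Polynomial.eval₂_X]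

/-- **Iterating a kernel-preserving shear.** If `E_b (φ f) = E_{b + cv} f` for all `b` (a shear
identity) and the kernels of `E_a` and `E_{a + cv}` agree, then every `f` killed by `E_a` is killed
by all `E_{a + j·cv}`, `j ∈ ℕ` (the common kernel is `φ`-stable, and `E_a ∘ φ^j = E_{a + j·cv}`). -/
theorem algPeriod_iterate_eq_zero {R S : Type*} [Zero S] (E : (Fin n → ℂ) → R → S) (φ : R → R)
    (c : ℂ) (v : Fin n → ℤ) (hE : ∀ b f, E b (φ f) = E (fun i => b i + c * (v i : ℂ)) f)
    (a a' : Fin n → ℂ) (ha : (fun i => a i + c * (v i : ℂ)) = a')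
    (hker : ∀ f, E a f = 0 ↔ E a' f = 0) (f : R) (hf : E a f = 0) (j : ℕ) :
    E (fun i => a i + (j : ℂ) * c * (v i : ℂ)) f = 0 := by
  have hst : ∀ g, E a g = 0 → E a (φ g) = 0 := fun g hg => by
    rw [hE, ha]
    exact (hker g).1 hg
  have hit : ∀ j : ℕ, ∀ g, E a g = 0 → E a (φ^[j] g) = 0 := by
    intro j
    induction j with
    | zero => intro g hg; simpa only [Function.iterate_zero, id_eq] using hg
    | succ j ih => intro g hg; rw [Function.iterate_succ_apply']; exact hst _ (ih g hg)
  have hiter : ∀ j : ℕ, ∀ b g, E b (φ^[j] g) = E (fun i => b i + (j : ℂ) * c * (v i : ℂ)) g := by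
    intro j
    induction j with
    | zero => intro b g; simp only [Function.iterate_zero, id_eq, Nat.cast_zero, zero_mul, add_zero]
    | succ j ih =>
      intro b g
      rw [Function.iterate_succ_apply, ih, hE]
      congr 2
      funext i
      push_cast
      ring
  rw [← hiter]
  exact hit j f hf

/-- **Stub 4b-alg — the line when `2πi` is algebraic over `ℚ(eˣ)`.** For a first failure `x` of
rank `n ≥ 3` with infinitely many mate-translates `x + 2πik` (`k ∈ D`) and `2πi` algebraic over
`ℚ(eˣ)`, there are `k₀ ∈ D` and `v ∈ ℤⁿ ∖ 0` such that the complex line `x + 2πik₀ + ℂv` lies in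
the fibre `W_y` of the ℚ-locus of `(x, eˣ)`: two distinct `k₁, k₂ ∈ D` give the same ideal of
`(x + 2πik, eˣ, 2πi)` over `ℚ[X, Y][T]` (`algPeriod_exists_ne_ker_eq`); this ideal is stable under
the shear `X ↦ X + T(k₂ - k₁)` (`algPeriod_shear_comp`), so `x + 2πik₁ + j·2πi(k₂ - k₁) ∈ W_y` for
all `j ∈ ℕ` (`algPeriod_iterate_eq_zero`), and a line meeting `W_y` infinitely often lies in it
(`aeval_line_eq_zero_of_infinite`).  Output: `k₀ = k₁`, `v = k₂ - k₁`. -/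
theorem stub_sweepLine_algPeriod : ∀ (n : ℕ), 3 ≤ n → ∀ (x : Fin n → ℂ), (LinearIndependent ℚ x ∧ Algebra.trdeg ℚ ↥(IntermediateField.adjoin ℚ (Set.range x ∪ Set.range (Complex.exp ∘ x))) < (n : Cardinal) ∧ ∀ r < n, Literature.NumberTheory.Transcendental.SchanuelRank r) → {k : Fin n → ℤ | LinearIndependent ℚ (fun i => x i + 2 * ↑Real.pi * Complex.I * (k i : ℂ)) ∧ ∀ p : MvPolynomial (Fin n ⊕ Fin n) ℚ, MvPolynomial.aeval (Sum.elim x (Complex.exp ∘ x)) p = 0 → MvPolynomial.aeval (Sum.elim (fun i => x i + 2 * ↑Real.pi * Complex.I * (k i : ℂ)) (Complex.exp ∘ fun i => x i + 2 * ↑Real.pi * Complex.I * (k i : ℂ))) p = 0}.Infinite → IsAlgebraic ↥(IntermediateField.adjoin ℚ (Set.range (Complex.exp ∘ x))) (2 * ↑Real.pi * Complex.I) → (∃ (k₀ v : Fin n → ℤ), v ≠ 0 ∧ (LinearIndependent ℚ (fun i => x i + 2 * ↑Real.pi * Complex.I * (k₀ i : ℂ)) ∧ ∀ p : MvPolynomial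 (Fin n ⊕ Fin n) ℚ, MvPolynomial.aeval (Sum.elim x (Complex.exp ∘ x)) p = 0 → MvPolynomial.aeval (Sum.elim (fun i => x i + 2 * ↑Real.pi * Complex.I * (k₀ i : ℂ)) (Complex.exp ∘ fun i => x i + 2 * ↑Real.pi * Complex.I * (k₀ i : ℂ))) p = 0) ∧ ∀ s : ℂ, ∀ p : MvPolynomial (Fin n ⊕ Fin n) ℚ, MvPolynomial.aeval (Sum.elim x (Complex.exp ∘ x)) p = 0 → MvPolynomial.aeval (Sum.elim (fun i => x i + 2 * ↑Real.pi * Complex.I * (k₀ i : ℂ) + s * (v i : ℂ)) (Complex.exp ∘ x)) p = 0) := by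
  intro n _hn x hx hD halg
  classical
  haveI : (RingHom.ker (MvPolynomial.aeval (Sum.elim x (Complex.exp ∘ x)) :
      MvPolynomial (Fin n ⊕ Fin n) ℚ →ₐ[ℚ] ℂ)).IsPrime := RingHom.ker_isPrime _
  have hc0 : (2 * ↑Real.pi * Complex.I : ℂ) ≠ 0 := by simp [Real.pi_ne_zero, Complex.I_ne_zero]
  -- two distinct translates `x + 2πik`, `k ∈ D` (generic points of `P`), with the same ideal
  have hinj : Function.Injective
      (fun k : Fin n → ℤ => fun i => x i + 2 * ↑Real.pi * Complex.I * (k i : ℂ)) := by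
    intro k k' h
    funext i
    have : (k i : ℂ) = (k' i : ℂ) := mul_left_cancel₀ hc0 (add_left_cancel (congrFun h i))
    exact_mod_cast this
  obtain ⟨a₁, ⟨k₁, hk₁, rfl⟩, a₂, ⟨k₂, hk₂, rfl⟩, hne, hker⟩ :=
    algPeriod_exists_ne_ker_eq (RingHom.ker (MvPolynomial.aeval (Sum.elim x (Complex.exp ∘ x)) :
        MvPolynomial (Fin n ⊕ Fin n) ℚ →ₐ[ℚ] ℂ)) (Complex.exp ∘ x) (2 * ↑Real.pi * Complex.I) halg
      ((Set.infinite_image_iff hinj.injOn).2 hD)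
      (Set.forall_mem_image.2 fun k hk => algPeriod_isGenericPt_kerTranslate x hx k hk)
  have hk12 : k₁ ≠ k₂ := fun h => hne (by rw [h])
  refine ⟨k₁, k₂ - k₁, sub_ne_zero.2 (Ne.symm hk12), hk₁, fun s p hp => ?_⟩
  -- the points `x + 2πik₁ + j·2πi(k₂ - k₁)`, `j ∈ ℕ`, lie in the fibre (shear iteration)
  have hshift : (fun i => x i + 2 * ↑Real.pi * Complex.I * (k₁ i : ℂ) +
      2 * ↑Real.pi * Complex.I * ((k₂ - k₁) i : ℂ)) =
      fun i => x i + 2 * ↑Real.pi * Complex.I * (k₂ i : ℂ) := by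
    funext i; simp only [Pi.sub_apply, Int.cast_sub]; ring
  have hp₁ : Polynomial.eval₂RingHom (MvPolynomial.eval₂Hom (algebraMap ℚ ℂ)
      (Sum.elim (fun i => x i + 2 * ↑Real.pi * Complex.I * (k₁ i : ℂ)) (Complex.exp ∘ x)))
      (2 * ↑Real.pi * Complex.I) (Polynomial.C p) = 0 := by
    rw [Polynomial.coe_eval₂RingHom, Polynomial.eval₂_C, ← MvPolynomial.aeval_eq_eval₂Hom]
    have := hk₁.2 p hp
    rwa [cexp_kerTranslate] at this
  have hpts : ∀ j : ℕ, MvPolynomial.aeval (Sum.elim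
      (fun i => x i + 2 * ↑Real.pi * Complex.I * (k₁ i : ℂ) +
        (j : ℂ) * (2 * ↑Real.pi * Complex.I) * ((k₂ - k₁) i : ℂ)) (Complex.exp ∘ x)) p = 0 := by
    intro j
    have h := algPeriod_iterate_eq_zero
      (fun b => ⇑(Polynomial.eval₂RingHom
        (MvPolynomial.eval₂Hom (algebraMap ℚ ℂ) (Sum.elim b (Complex.exp ∘ x)))
        (2 * ↑Real.pi * Complex.I)))
      (Polynomial.eval₂RingHom (MvPolynomial.eval₂Hom
        (algebraMap ℚ (Polynomial (MvPolynomial (Fin n ⊕ Fin n) ℚ)))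
        (Sum.elim (fun i => Polynomial.C (MvPolynomial.X (Sum.inl i)) +
          Polynomial.X * Polynomial.C (MvPolynomial.C ((k₂ - k₁) i : ℚ)))
          (fun i => Polynomial.C (MvPolynomial.X (Sum.inr i))))) Polynomial.X)
      (2 * ↑Real.pi * Complex.I) (k₂ - k₁)
      (fun b f => RingHom.congr_fun (algPeriod_shear_comp (Complex.exp ∘ x) b _ (k₂ - k₁)) f)
      _ _ hshift hker (Polynomial.C p) hp₁ j
    simp only [Polynomial.coe_eval₂RingHom, Polynomial.eval₂_C] at h
    rw [MvPolynomial.aeval_eq_eval₂Hom]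
    exact h
  -- hence the whole line does
  have hinf : {t : ℂ | MvPolynomial.aeval (Sum.elim
      (fun i => (x i + 2 * ↑Real.pi * Complex.I * (k₁ i : ℂ)) + t * ((k₂ - k₁) i : ℂ))
      (Complex.exp ∘ x)) p = 0}.Infinite := by
    refine Set.infinite_of_injective_forall_mem
      (f := fun j : ℕ => (j : ℂ) * (2 * ↑Real.pi * Complex.I)) (fun j j' h => ?_) fun j => ?_
    · exact Nat.cast_injective (mul_right_cancel₀ hc0 h)
    · rw [Set.mem_setOf_eq]
      exact hpts j
  exact aeval_line_eq_zero_of_infinite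
    (fun i => x i + 2 * ↑Real.pi * Complex.I * (k₁ i : ℂ)) (fun i => ((k₂ - k₁) i : ℂ))
    (Complex.exp ∘ x) p hinf s

end Summit.Schanuel.Schanuel.Cruxes.MinimalCounterexampleInAcl.KernelArithmeticSelection
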